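import Summits.RiemannHypothesis.RiemannHypothesis.Theorems.WeilFormatCPolyWindowMixedRegroup
import Summits.RiemannHypothesis.RiemannHypothesis.Theorems.WeilFormatCWindowPolyProfile
import Summits.RiemannHypothesis.RiemannHypothesis.Theorems.WeilFormatCCinfCouplingFamilies
import Summits.RiemannHypothesis.RiemannHypothesis.Theorems.WeilFormatCCinfMonomialAlgebra
import HarnessLib

/-!
# Format C, design C∞ (E3, analytic side): the profile tables `V^±_j(m)` of polynomial profiles, COLLECTED by power

Route context: Fourier–Galerkin / Schur-complement certificates of Weil positivity on a window ("format C", C∞ door;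
cell memo `run/shared/lean/pub/rh-explicit/rh-explicit-weil-10/KERNEL-LEVER.md` §21; supporting stmt-RiemannHypothesis-0098;
seat rh-explicit-weil-10).  The `hV` hypothesis of `cinf_hUq_even/odd` (`WeilFormatCCinfCouplingEven/Odd`) asks for the
far profile table of a polynomial profile `f_j = Σ_{q∈s} c_{jq} x^q` in collected family form.  From the closed window
coefficients of the monomials (`fourierCoeff_ofReal_pow_eq_sum`, `WeilFormatCWindowCoeffDecay`; `inv_negI_freq_pow`;
`fourierCoeff_indicator`, `WeilFormatCWindowPolyProfile`):

* `re_fourierCoeff_pow_nat`, `im_fourierCoeff_pow_nat` — for natural modes `m ≠ 0`: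
  `Re/Im ĉ_m(x^q) = (−1)^m Σ_{k≤q} [(−1)^k q^{(k)}(a^{q−k} − (−a)^{q−k})(a/π)^{k+1} Re/Im(i^{k+1})]/m^{k+1}` (flat monomials);
* ★ `evenVTable_collected` — `d_m² Re ĉ_m(1f_j)/√(2a) = (−1)^m Σ_{d≤D} RV⁺(d)/m^d` (`m ≠ 0`, `q + 1 ≤ D` on `s`),
  `RV⁺(d)` the fiber sum over `{(q,k) : q ∈ s, k ≤ q, k+1 = d}`;
* ★ `oddVTable_collected` — `2 Im ĉ_m(1f_j)/√(2a) = (−1)^m Σ_{d≤D} RV⁻(d)/m^d`;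
* `oneGroup_eq_sum_fin` — a pure group as ONE family sum over `Fin 4 × Fin (D+1)` (zero `log`/`C`/`S` rows), so the
  table shares the family index of the rows and images; `evenVTable_family`, `oddVTable_family` — the tables in
  that form (literally the `hV` shape of `cinf_hUq_even/odd`).

Pure algebra over the landed closed forms; standard axioms; no definitions; no RH claim.
-/

set_option autoImplicit false
-- `Summit.RiemannHypothesis.RiemannHypothesis.…` is the layout-mandated namespace (summit = problem name).
set_option linter.dupNamespace false

noncomputable section

open Complex Filter Set MeasureTheory Finset
open scoped Real Topology ComplexConjugate ArithmeticFunction.vonMangoldt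

namespace Summit.RiemannHypothesis.RiemannHypothesis.Theorems.WeilFormatC

open Literature.NumberTheory.LFunctions Literature.NumberTheory.LFunctions.Yoshida1992

variable {a : ℝ}

/-! ## Window coefficients of the monomials as flat monomials in `1/m` -/

/-- `ĉ_m(x^q)` for a natural mode `m ≠ 0` as a flat monomial sum (complex form). -/
theorem fourierCoeff_pow_nat (ha : a ≠ 0) {m : ℕ} (hm : m ≠ 0) (q : ℕ) :
    Yoshida1992.fourierCoeff a m (fun x : ℝ ↦ ((x : ℂ)) ^ q)
      = (-1 : ℂ) ^ m * ∑ k ∈ Finset.range (q + 1),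
          (((-1 : ℝ) ^ k * (q.descFactorial k : ℝ) * (a ^ (q - k) - (-a) ^ (q - k)) * (a / π) ^ (k + 1)
              / (m : ℝ) ^ (k + 1) : ℝ) : ℂ) * I ^ (k + 1) := by
  have hmz : (m : ℤ) ≠ 0 := by exact_mod_cast hm
  have hmr : (m : ℝ) ≠ 0 := by exact_mod_cast hm
  have h := fourierCoeff_ofReal_pow_eq_sum ha hmz q
  rw [zpow_natCast] at h
  rw [h]
  congr 1
  refine Finset.sum_congr rfl fun k _ ↦ ?_
  have hbase : (I * (π * ((-(m : ℤ) : ℤ) : ℝ) / a : ℝ) : ℂ) = -(I * (π * ((m : ℤ) : ℝ) / a : ℝ)) := by push_cast; ring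
  rw [hbase, div_eq_mul_one_div, inv_negI_freq_pow ha hmz k, mul_pow, Int.cast_natCast,
    show (a / (π * m) : ℝ) = (a / π) / m by rw [div_div], Complex.ofReal_div, div_pow]
  push_cast
  ring

/-- **`Re ĉ_m(x^q)` as flat monomials** (`a ≠ 0`, natural `m ≠ 0`):
`Re ĉ_m(x^q) = (−1)^m Σ_{k≤q} [(−1)^k q^{(k)}(a^{q−k} − (−a)^{q−k})(a/π)^{k+1}Re(i^{k+1})]/m^{k+1}`. -/
theorem re_fourierCoeff_pow_nat (ha : a ≠ 0) {m : ℕ} (hm : m ≠ 0) (q : ℕ) :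
    (Yoshida1992.fourierCoeff a m (fun x : ℝ ↦ ((x : ℂ)) ^ q)).re
      = (-1 : ℝ) ^ m * ∑ k ∈ Finset.range (q + 1),
          ((-1 : ℝ) ^ k * (q.descFactorial k : ℝ) * (a ^ (q - k) - (-a) ^ (q - k)) * (a / π) ^ (k + 1)
            * (I ^ (k + 1)).re) / (m : ℝ) ^ (k + 1) := by
  rw [fourierCoeff_pow_nat ha hm q]
  have hsgn : ((-1 : ℂ)) ^ m = (((-1 : ℝ) ^ m : ℝ) : ℂ) := by push_cast; rfl
  rw [hsgn, Complex.re_ofReal_mul, Complex.re_sum]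
  congr 1
  refine Finset.sum_congr rfl fun k _ ↦ ?_
  rw [Complex.re_ofReal_mul]
  ring

/-- **`Im ĉ_m(x^q)` as flat monomials** (`a ≠ 0`, natural `m ≠ 0`). -/
theorem im_fourierCoeff_pow_nat (ha : a ≠ 0) {m : ℕ} (hm : m ≠ 0) (q : ℕ) :
    (Yoshida1992.fourierCoeff a m (fun x : ℝ ↦ ((x : ℂ)) ^ q)).im
      = (-1 : ℝ) ^ m * ∑ k ∈ Finset.range (q + 1),
          ((-1 : ℝ) ^ k * (q.descFactorial k : ℝ) * (a ^ (q - k) - (-a) ^ (q - k)) * (a / π) ^ (k + 1)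
            * (I ^ (k + 1)).im) / (m : ℝ) ^ (k + 1) := by
  rw [fourierCoeff_pow_nat ha hm q]
  have hsgn : ((-1 : ℂ)) ^ m = (((-1 : ℝ) ^ m : ℝ) : ℂ) := by push_cast; rfl
  rw [hsgn, Complex.im_ofReal_mul, Complex.im_sum]
  congr 1
  refine Finset.sum_congr rfl fun k _ ↦ ?_
  rw [Complex.im_ofReal_mul]
  ring

/-- Linearity of the window coefficient over a real polynomial window (each monomial integrand is continuous). -/
theorem fourierCoeff_poly (a : ℝ) (n : ℤ) (s : Finset ℕ) (c : ℕ → ℝ) :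
    Yoshida1992.fourierCoeff a n (fun x : ℝ ↦ ∑ q ∈ s, ((c q : ℝ) : ℂ) * ((x : ℂ)) ^ q)
      = ∑ q ∈ s, ((c q : ℝ) : ℂ) * Yoshida1992.fourierCoeff a n (fun x : ℝ ↦ ((x : ℂ)) ^ q) := by
  unfold Yoshida1992.fourierCoeff
  have hint : ∀ q ∈ s, IntervalIntegrable (fun x : ℝ ↦ ((c q : ℝ) : ℂ) * ((x : ℂ)) ^ q * cexp (-(π * I * n * x / a)))
      MeasureTheory.volume (-a) a := fun q _ ↦
    (Continuous.intervalIntegrable (by fun_prop) _ _)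
  rw [← (intervalIntegral.integral_finsetSum hint).symm.trans (intervalIntegral.integral_congr fun x _ ↦ by
    simp only [Finset.sum_mul])]
  refine Finset.sum_congr rfl fun q _ ↦ ?_
  rw [← intervalIntegral.integral_const_mul]
  exact intervalIntegral.integral_congr fun x _ ↦ by ring

/-! ## The collected tables -/

/-- **The even profile table collected by power** (`a > 0`, natural `m ≠ 0`, `q + 1 ≤ D` on `s`):
`d_m² Re ĉ_m(1·Σ_q c_q x^q)/√(2a) = (−1)^m Σ_{d≤D} RV⁺(d)/m^d`,
`RV⁺(d) = Σ_{(q,k): k+1 = d} 2c_q(−1)^k q^{(k)}(a^{q−k} − (−a)^{q−k})(a/π)^{k+1}Re(i^{k+1})/√(2a)`. -/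
theorem evenVTable_collected (ha : 0 < a) {m : ℕ} (hm : m ≠ 0) (s : Finset ℕ) (c : ℕ → ℝ) {D : ℕ}
    (hD : ∀ q ∈ s, q + 1 ≤ D) :
    (if m = 0 then (1 : ℝ) else 2) * (Yoshida1992.fourierCoeff a m
        ((Icc (-a) a).indicator fun x : ℝ ↦ ∑ q ∈ s, ((c q : ℝ) : ℂ) * ((x : ℂ)) ^ q)).re / Real.sqrt (2 * a)
      = (-1 : ℝ) ^ m * ∑ d ∈ Finset.range (D + 1),
          (∑ p ∈ (s.sigma fun q ↦ Finset.range (q + 1)).filter (fun p ↦ p.2 + 1 = d),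
              2 * c p.1 * ((-1 : ℝ) ^ p.2 * (p.1.descFactorial p.2 : ℝ) * (a ^ (p.1 - p.2) - (-a) ^ (p.1 - p.2))
                * (a / π) ^ (p.2 + 1) * (I ^ (p.2 + 1)).re) / Real.sqrt (2 * a)) / (m : ℝ) ^ d := by
  rw [if_neg hm, fourierCoeff_indicator ha.le, fourierCoeff_poly, Complex.re_sum]
  simp_rw [Complex.re_ofReal_mul, re_fourierCoeff_pow_nat ha.ne' hm]
  rw [← sum_div_pow_eq_sum_fiber (s.sigma fun q ↦ Finset.range (q + 1))
    (fun p ↦ 2 * c p.1 * ((-1 : ℝ) ^ p.2 * (p.1.descFactorial p.2 : ℝ) * (a ^ (p.1 - p.2) - (-a) ^ (p.1 - p.2))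
        * (a / π) ^ (p.2 + 1) * (I ^ (p.2 + 1)).re) / Real.sqrt (2 * a)) (fun p ↦ p.2 + 1)
    (fun p hp ↦ by
      have h1 := hD p.1 (Finset.mem_sigma.1 hp).1
      have h2 := Finset.mem_range.1 (Finset.mem_sigma.1 hp).2
      omega),
    Finset.sum_sigma, Finset.mul_sum, Finset.sum_div, Finset.mul_sum]
  refine Finset.sum_congr rfl fun q _ ↦ ?_
  rw [Finset.mul_sum, Finset.mul_sum]
  simp only [Finset.mul_sum, Finset.sum_div]
  exact Finset.sum_congr rfl fun k _ ↦ by ring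

/-- **The odd profile table collected by power** (`a > 0`, natural `m ≠ 0`, `q + 1 ≤ D` on `s`):
`2 Im ĉ_m(1·Σ_q c_q x^q)/√(2a) = (−1)^m Σ_{d≤D} RV⁻(d)/m^d` with `Im(i^{k+1})` in place of `Re`. -/
theorem oddVTable_collected (ha : 0 < a) {m : ℕ} (hm : m ≠ 0) (s : Finset ℕ) (c : ℕ → ℝ) {D : ℕ}
    (hD : ∀ q ∈ s, q + 1 ≤ D) :
    2 * (Yoshida1992.fourierCoeff a m
        ((Icc (-a) a).indicator fun x : ℝ ↦ ∑ q ∈ s, ((c q : ℝ) : ℂ) * ((x : ℂ)) ^ q)).im / Real.sqrt (2 * a)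
      = (-1 : ℝ) ^ m * ∑ d ∈ Finset.range (D + 1),
          (∑ p ∈ (s.sigma fun q ↦ Finset.range (q + 1)).filter (fun p ↦ p.2 + 1 = d),
              2 * c p.1 * ((-1 : ℝ) ^ p.2 * (p.1.descFactorial p.2 : ℝ) * (a ^ (p.1 - p.2) - (-a) ^ (p.1 - p.2))
                * (a / π) ^ (p.2 + 1) * (I ^ (p.2 + 1)).im) / Real.sqrt (2 * a)) / (m : ℝ) ^ d := by
  rw [fourierCoeff_indicator ha.le, fourierCoeff_poly, Complex.im_sum]
  simp_rw [Complex.im_ofReal_mul, im_fourierCoeff_pow_nat ha.ne' hm]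
  rw [← sum_div_pow_eq_sum_fiber (s.sigma fun q ↦ Finset.range (q + 1))
    (fun p ↦ 2 * c p.1 * ((-1 : ℝ) ^ p.2 * (p.1.descFactorial p.2 : ℝ) * (a ^ (p.1 - p.2) - (-a) ^ (p.1 - p.2))
        * (a / π) ^ (p.2 + 1) * (I ^ (p.2 + 1)).im) / Real.sqrt (2 * a)) (fun p ↦ p.2 + 1)
    (fun p hp ↦ by
      have h1 := hD p.1 (Finset.mem_sigma.1 hp).1
      have h2 := Finset.mem_range.1 (Finset.mem_sigma.1 hp).2
      omega),
    Finset.sum_sigma, Finset.mul_sum, Finset.sum_div, Finset.mul_sum]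
  refine Finset.sum_congr rfl fun q _ ↦ ?_
  rw [Finset.mul_sum, Finset.mul_sum]
  simp only [Finset.mul_sum, Finset.sum_div]
  exact Finset.sum_congr rfl fun k _ ↦ by ring

/-- **A pure group as ONE family sum** over `Fin 4 × Fin (D+1)` (zero `L`-, `C`-, `S`-rows) — the profile table in the
family index of the rows and images. -/
theorem oneGroup_eq_sum_fin (P₁ : ℕ → ℝ) (L C S m : ℝ) (D : ℕ) :
    ∑ d ∈ Finset.range (D + 1), P₁ d / m ^ d
      = ∑ x : Fin 4 × Fin (D + 1),
          (![P₁, fun _ ↦ 0, fun _ ↦ 0, fun _ ↦ 0] x.1) x.2 * (![(1 : ℝ), L, -C, S] x.1 / m ^ (x.2 : ℕ)) := by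
  rw [← fourGroups_eq_sum_fin P₁ (fun _ ↦ 0) (fun _ ↦ 0) (fun _ ↦ 0) L C S m D]
  simp only [zero_div, Finset.sum_const_zero, mul_zero, add_zero, sub_zero]

/-! ## Family forms -/

/-- **Family form** of `evenVTable_collected` over `Fin 4 × Fin (D+1)` (`oneGroup_eq_sum_fin`; tags `1, log m, −C_m, S_m`) —
literally the `hV` shape of `cinf_hUq_even/odd`. -/
theorem evenVTable_family (ha : 0 < a) {m : ℕ} (hm : m ≠ 0) (s : Finset ℕ) (c : ℕ → ℝ) {D : ℕ}
    (hD : ∀ q ∈ s, q + 1 ≤ D) :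
    (if m = 0 then (1 : ℝ) else 2) * (Yoshida1992.fourierCoeff a m
        ((Icc (-a) a).indicator fun x : ℝ ↦ ∑ q ∈ s, ((c q : ℝ) : ℂ) * ((x : ℂ)) ^ q)).re / Real.sqrt (2 * a)
      = (-1 : ℝ) ^ m * ∑ x : Fin 4 × Fin (D + 1),
          ((![fun d : ℕ ↦ ∑ p ∈ (s.sigma fun q ↦ Finset.range (q + 1)).filter (fun p ↦ p.2 + 1 = d),
              2 * c p.1 * ((-1 : ℝ) ^ p.2 * (p.1.descFactorial p.2 : ℝ) * (a ^ (p.1 - p.2) - (-a) ^ (p.1 - p.2))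
                * (a / π) ^ (p.2 + 1) * (I ^ (p.2 + 1)).re) / Real.sqrt (2 * a),
              fun _ ↦ 0, fun _ ↦ 0, fun _ ↦ 0] x.1) x.2)
            * (![(1 : ℝ), Real.log m, -(∑ n ∈ weilPrimeIndex a, (Λ n : ℝ) / Real.sqrt n * Real.cos (π * m / a * Real.log n)), (∑ n ∈ weilPrimeIndex a, (Λ n : ℝ) / Real.sqrt n * Real.sin (π * m / a * Real.log n))] x.1 / (m : ℝ) ^ (x.2 : ℕ)) := by
  rw [← oneGroup_eq_sum_fin]
  exact evenVTable_collected (ha := ha) (m := m) (hm := hm) (s := s) (c := c) (D := D) (hD := hD)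

/-- **Family form** of `oddVTable_collected` over `Fin 4 × Fin (D+1)` (`oneGroup_eq_sum_fin`; tags `1, log m, −C_m, S_m`) —
literally the `hV` shape of `cinf_hUq_even/odd`. -/
theorem oddVTable_family (ha : 0 < a) {m : ℕ} (hm : m ≠ 0) (s : Finset ℕ) (c : ℕ → ℝ) {D : ℕ}
    (hD : ∀ q ∈ s, q + 1 ≤ D) :
    2 * (Yoshida1992.fourierCoeff a m
        ((Icc (-a) a).indicator fun x : ℝ ↦ ∑ q ∈ s, ((c q : ℝ) : ℂ) * ((x : ℂ)) ^ q)).im / Real.sqrt (2 * a)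
      = (-1 : ℝ) ^ m * ∑ x : Fin 4 × Fin (D + 1),
          ((![fun d : ℕ ↦ ∑ p ∈ (s.sigma fun q ↦ Finset.range (q + 1)).filter (fun p ↦ p.2 + 1 = d),
              2 * c p.1 * ((-1 : ℝ) ^ p.2 * (p.1.descFactorial p.2 : ℝ) * (a ^ (p.1 - p.2) - (-a) ^ (p.1 - p.2))
                * (a / π) ^ (p.2 + 1) * (I ^ (p.2 + 1)).im) / Real.sqrt (2 * a),
              fun _ ↦ 0, fun _ ↦ 0, fun _ ↦ 0] x.1) x.2)
            * (![(1 : ℝ), Real.log m, -(∑ n ∈ weilPrimeIndex a, (Λ n : ℝ) / Real.sqrt n * Real.cos (π * m / a * Real.log n)), (∑ n ∈ weilPrimeIndex a, (Λ n : ℝ) / Real.sqrt n * Real.sin (π * m / a * Real.log n))] x.1 / (m : ℝ) ^ (x.2 : ℕ)) := by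
  rw [← oneGroup_eq_sum_fin]
  exact oddVTable_collected (ha := ha) (m := m) (hm := hm) (s := s) (c := c) (D := D) (hD := hD)

end Summit.RiemannHypothesis.RiemannHypothesis.Theorems.WeilFormatC
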